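import Mathlib
import Summits.Ventures.Crystal3D.Theorems.StickyWulffConstantLayerChainDefs
import HarnessLib

/-!
# Tent windows from six vertices, and convexity of the sections `stackSlice f y`
# (BLUEPRINT L2 + the interpolation half of L4 for stub `stub_sliceDomination`, line `LayerChain`,
# crux `StackingLiminf`, stmt-Ventures-19145)

Route `StickyWulffConstant` of the venture `Summits/Ventures/Crystal3D` (cell `crystal3d-full`).
(1) Every section `stackSlice f y` of a homogenised stacking Wulff body is CONVEX (an
intersection of closed half-planes).  (2) A convex planar set containing the six vertices
`(±(P − κ(c−a)), a)`, `(±P, c)`, `(±(P − κ(b−c)), b)` of a tent window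
`{p | a ≤ p.2 ≤ b, |p.1| ≤ P − κ|p.2 − c|}` (`a < c < b`, `0 ≤ κ`, `κ(c−a) < P`, `κ(b−c) < P`)
contains the whole window (two one-dimensional interpolations: along the edges to the boundary
points `(±X(u), u)`, then across).  With the vertex certificates of cf-p2 R19 this gives the
INNER half of slice domination.
WHAT THIS IS NOT: the vertex certificates, slice domination, or anything about the crux;
rung F-C1 not moved.
-/

noncomputable section

namespace Summit.Ventures.Crystal3D.Theorems

open Set
open Summit.Ventures.Crystal3D.LayerChain

/-- `dot3` is linear in its first argument along segments. -/
theorem dot3_vec3_combo (θ₁ θ₂ x₁ y₁ x₂ y₂ y : ℝ) (n : Fin 3 → ℝ) (hθ : θ₁ + θ₂ = 1) :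
    dot3 ![θ₁ * x₁ + θ₂ * x₂, θ₁ * y₁ + θ₂ * y₂, y] n =
      θ₁ * dot3 ![x₁, y₁, y] n + θ₂ * dot3 ![x₂, y₂, y] n := by
  simp only [dot3, Fin.isValue, Matrix.cons_val_zero, Matrix.cons_val_one, Matrix.cons_val_two,
    Matrix.head_cons, Matrix.tail_cons]
  linear_combination (-(y * n 2)) * hθ

/-- **BLUEPRINT L2.** Every horizontal section of `W_f` is convex. -/
theorem convex_stackSlice (f y : ℝ) : Convex ℝ (stackSlice f y) := by
  intro p hp q hq θ₁ θ₂ hθ₁ hθ₂ hθ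
  show (![(θ₁ • p + θ₂ • q).1, (θ₁ • p + θ₂ • q).2, y] : Fin 3 → ℝ) ∈ stackWulff f
  intro n τ
  have e : (![(θ₁ • p + θ₂ • q).1, (θ₁ • p + θ₂ • q).2, y] : Fin 3 → ℝ) =
      ![θ₁ * p.1 + θ₂ * q.1, θ₁ * p.2 + θ₂ * q.2, y] := by
    simp [Prod.smul_fst, Prod.smul_snd, smul_eq_mul]
  rw [e, dot3_vec3_combo _ _ _ _ _ _ _ _ hθ]
  have h1 := hp n τ
  have h2 := hq n τ
  have : θ₁ * dot3 ![p.1, p.2, y] n + θ₂ * dot3 ![q.1, q.2, y] n ≤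
      θ₁ * stackPhi f n τ + θ₂ * stackPhi f n τ := by gcongr
  simpa [← add_mul, hθ] using this

/-- A point of a convex planar set from two of its points, with explicit weights. -/
theorem mem_of_convex_combo {C : Set (ℝ × ℝ)} (hC : Convex ℝ C) {p q : ℝ × ℝ} (hp : p ∈ C)
    (hq : q ∈ C) {θ : ℝ} (h0 : 0 ≤ θ) (h1 : θ ≤ 1) {r : ℝ × ℝ}
    (hr1 : r.1 = (1 - θ) * p.1 + θ * q.1) (hr2 : r.2 = (1 - θ) * p.2 + θ * q.2) : r ∈ C := by
  have h := hC hp hq (sub_nonneg.2 h1) h0 (by ring)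
  convert h using 1
  ext <;> simp [hr1, hr2, smul_eq_mul]

/-- **Interpolation half of BLUEPRINT L4.** A convex planar set containing the six vertices of a
(non-degenerate) tent window contains the window. -/
theorem tentWindow_subset_of_convex {C : Set (ℝ × ℝ)} (hC : Convex ℝ C) {a b c P κ : ℝ}
    (hac : a < c) (hcb : c < b) (hκ : 0 ≤ κ) (hPa : κ * (c - a) < P) (hPb : κ * (b - c) < P)
    (h1 : (-(P - κ * (c - a)), a) ∈ C) (h2 : (P - κ * (c - a), a) ∈ C) (h3 : (P, c) ∈ C)
    (h4 : (P - κ * (b - c), b) ∈ C) (h5 : (-(P - κ * (b - c)), b) ∈ C) (h6 : (-P, c) ∈ C) :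
    {p : ℝ × ℝ | a ≤ p.2 ∧ p.2 ≤ b ∧ |p.1| ≤ P - κ * |p.2 - c|} ⊆ C := by
  rintro ⟨x, u⟩ ⟨hau, hub, hx⟩
  simp only at hau hub hx
  -- the boundary points `(±X, u)`, `X = P − κ |u − c|`, lie in `C`
  set X := P - κ * |u - c| with hX
  have hXpos : 0 < X := by
    rcases le_total u c with h | h
    · rw [hX, abs_of_nonpos (sub_nonpos.2 h), neg_sub]
      nlinarith [mul_le_mul_of_nonneg_left (sub_le_sub_left hau c) hκ]
    · rw [hX, abs_of_nonneg (sub_nonneg.2 h)]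
      nlinarith [mul_le_mul_of_nonneg_left (sub_le_sub_right hub c) hκ]
  have hB : (X, u) ∈ C ∧ (-X, u) ∈ C := by
    rcases le_total u c with h | h
    · -- interpolate between height `a` and height `c`
      have hXe : X = P - κ * (c - u) := by rw [hX, abs_of_nonpos (sub_nonpos.2 h), neg_sub]
      set θ := (u - a) / (c - a) with hθ
      have hca : 0 < c - a := sub_pos.2 hac
      have hθ0 : 0 ≤ θ := div_nonneg (sub_nonneg.2 hau) hca.le
      have hθ1 : θ ≤ 1 := (div_le_one hca).2 (by linarith)
      have hθu : (1 - θ) * a + θ * c = u := by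
        rw [hθ]; field_simp; ring
      constructor
      · refine mem_of_convex_combo hC h2 h3 hθ0 hθ1 ?_ ?_
        · simp only; rw [hXe, hθ]; field_simp; ring
        · simp only; rw [hθu]
      · refine mem_of_convex_combo hC h1 h6 hθ0 hθ1 ?_ ?_
        · simp only; rw [hXe, hθ]; field_simp; ring
        · simp only; rw [hθu]
    · -- interpolate between height `c` and height `b`
      have hXe : X = P - κ * (u - c) := by rw [hX, abs_of_nonneg (sub_nonneg.2 h)]
      set θ := (u - c) / (b - c) with hθ
      have hbc : 0 < b - c := sub_pos.2 hcb
      have hθ0 : 0 ≤ θ := div_nonneg (sub_nonneg.2 h) hbc.le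
      have hθ1 : θ ≤ 1 := (div_le_one hbc).2 (by linarith)
      have hθu : (1 - θ) * c + θ * b = u := by
        rw [hθ]; field_simp; ring
      constructor
      · refine mem_of_convex_combo hC h3 h4 hθ0 hθ1 ?_ ?_
        · simp only; rw [hXe, hθ]; field_simp; ring
        · simp only; rw [hθu]
      · refine mem_of_convex_combo hC h6 h5 hθ0 hθ1 ?_ ?_
        · simp only; rw [hXe, hθ]; field_simp; ring
        · simp only; rw [hθu]
  -- then across, between `(-X, u)` and `(X, u)`
  obtain ⟨hBp, hBm⟩ := hB
  set μ := (X + x) / (2 * X) with hμ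
  have hxX : |x| ≤ X := hx
  rw [abs_le] at hxX
  have hμ0 : 0 ≤ μ := div_nonneg (by linarith) (by linarith)
  have hμ1 : μ ≤ 1 := (div_le_one (by linarith)).2 (by linarith)
  refine mem_of_convex_combo hC hBm hBp hμ0 hμ1 ?_ ?_
  · simp only; rw [hμ]; field_simp; ring
  · simp only; ring

end Summit.Ventures.Crystal3D.Theorems

end
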